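import Summits.ResolutionOfSingularities.ResolutionOfSingularities.Theorems.FrobeniusLadderFRationalResolutionMonoidAlgebraDimension
import Summits.ResolutionOfSingularities.ResolutionOfSingularities.Theorems.FrobeniusLadderFRationalResolutionFaceRetraction
import Literature.AlgebraicGeometry.Resolution.LogRegularResolutionHolds
import Literature.RingTheory.KrullDimension.AffineCatenary
import Mathlib.RingTheory.Localization.Ideal
import Mathlib.RingTheory.Localization.AtPrime.Basic
import Mathlib.RingTheory.KrullDimension.Basic
import Mathlib.RingTheory.Ideal.Quotient.Operations
import HarnessLib

/-!
# Affine toric varieties are log regular (Kato (2.1)); hence resolved over every field (Kato (10.4), PROVED in the tree)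

Support file for crux stmt-ResolutionOfSingularities-15317 (`FrobeniusLadder.FRationalResolution`), line `redirect`:
brick L5 of the leaf hands' census for `stub_diagonalizableQuotientResolution`. For a field `k` (any
characteristic) and a finitely generated submonoid `P ⊆ ℤⁿ` spanning `ℤⁿ`, the tautological chart
`P → k[P]`, `p ↦ x^p`, satisfies K. Kato's logarithmic regularity condition (*Toric singularities*, Amer. J. Math.
116 (1994), Def. (2.1)) at EVERY prime `𝔭` of `k[P]` (`isLogRegularAt_addMonoidAlgebra`): with `F = {p : x^p ∉ 𝔭}` the
face of `𝔭` and `I = (x^p : p ∉ F)`, one has `k[P]_𝔭/I ≅ k[F]_𝔮` — a localization of the Laurent ring `k[ℤF] ≅ k[ℤ^r]`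
at a prime, hence regular — and `ht 𝔭 = ht 𝔮 + (n − r)` by the dimension formula for the affine domains `k[P]`,
`k[F]` (`dim k[Q] = rank ℤQ`). If moreover `P` is saturated, the tree's PROVED theorem of Kato ((10.4),
`Kato1994_logRegular_hasResolution_holds`) yields: **every affine normal toric variety `Spec k[P]` over every field
has a resolution of singularities** (`hasResolution_Spec_addMonoidAlgebra`). This covers every affine
diagonalizable-quotient singularity `𝔸ⁿ/D(A)` with its toric structure (all dimensions, tame and wild), the local
models of the stub.

* `exists_face_of_isPrime` — the face `F ≤ P` of a prime of `k[P]`;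
* `addSubmonoid_fg_of_face` — faces of finitely generated monoids are finitely generated;
* `isLogRegularAt_addMonoidAlgebra` — Kato (2.1) for `k[P]` at every prime;
* `hasResolution_Spec_addMonoidAlgebra` — resolution of `Spec k[P]`, `P` fs.

Folklore (Kato 1994 Ex. (2.2)/(3.2); CLS 2011 Thm. 11.1.9 over any field); the only published theorem used,
Kato (10.4), is PROVED in the tree.
-/

-- single-problem summit: the doubled namespace component is forced
set_option linter.dupNamespace false

noncomputable section

namespace Summit.ResolutionOfSingularities.ResolutionOfSingularities.Theorems.FRationalResolution

open AddMonoidAlgebra Literature.AlgebraicGeometry.Resolution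

universe u

variable (k : Type u) [Field k] {n : ℕ} (P : AddSubmonoid (Fin n → ℤ))

/-- **The face of a prime.** For a prime `𝔭` of `k[P]` the exponents `p ∈ P` with `x^p ∉ 𝔭` form a face `F` of `P`
(a submonoid with `a + b ∈ F ⇒ a ∈ F`), the complement of the prime ideal `{p : x^p ∈ 𝔭}` of `P`. [folklore] -/
theorem exists_face_of_isPrime (𝔭 : Ideal (AddMonoidAlgebra k ↥P)) [𝔭.IsPrime] :
    ∃ F : AddSubmonoid (Fin n → ℤ), F ≤ P ∧ (∀ a ∈ P, ∀ b ∈ P, a + b ∈ F → a ∈ F) ∧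
      ∀ p : ↥P, (p : Fin n → ℤ) ∈ F ↔ AddMonoidAlgebra.single p (1 : k) ∉ 𝔭 := by
  have hmul : ∀ (a b : Fin n → ℤ) (ha : a ∈ P) (hb : b ∈ P),
      AddMonoidAlgebra.single (⟨a + b, P.add_mem ha hb⟩ : ↥P) (1 : k) =
        AddMonoidAlgebra.single (⟨a, ha⟩ : ↥P) 1 * AddMonoidAlgebra.single (⟨b, hb⟩ : ↥P) 1 := by
    intro a b ha hb
    rw [AddMonoidAlgebra.single_mul_single, mul_one]
    rfl
  refine ⟨{ carrier := {g | ∃ h : g ∈ P, AddMonoidAlgebra.single (⟨g, h⟩ : ↥P) (1 : k) ∉ 𝔭}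
            zero_mem' := ⟨P.zero_mem, ?_⟩
            add_mem' := ?_ }, ?_, ?_, ?_⟩
  · rintro a b ⟨ha, ha'⟩ ⟨hb, hb'⟩
    refine ⟨P.add_mem ha hb, ?_⟩
    rw [hmul a b ha hb]
    intro h
    rcases (‹𝔭.IsPrime›).mem_or_mem h with h | h
    · exact ha' h
    · exact hb' h
  · have h1 : AddMonoidAlgebra.single (⟨0, P.zero_mem⟩ : ↥P) (1 : k) = 1 := by
      rw [AddMonoidAlgebra.one_def]; rfl
    rw [h1]
    exact (Ideal.ne_top_iff_one 𝔭).1 (Ideal.IsPrime.ne_top ‹_›)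
  · rintro g ⟨hg, -⟩
    exact hg
  · rintro a ha b hb ⟨hab, hab'⟩
    refine ⟨ha, fun h => hab' ?_⟩
    have : AddMonoidAlgebra.single (⟨a + b, hab⟩ : ↥P) (1 : k) =
        AddMonoidAlgebra.single (⟨a, ha⟩ : ↥P) 1 * AddMonoidAlgebra.single (⟨b, hb⟩ : ↥P) 1 := hmul a b ha hb
    rw [this]
    exact Ideal.mul_mem_right _ _ h
  · rintro ⟨p, hp⟩
    constructor
    · rintro ⟨_, h⟩; exact h
    · intro h; exact ⟨hp, h⟩

/-- **Faces of finitely generated monoids are finitely generated**: a face `F` of `P` is generated by the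
generators of `P` lying in `F`. [folklore] -/
theorem addSubmonoid_fg_of_face {G : Type u} [AddCommMonoid G] {P F : AddSubmonoid G} (hP : P.FG) (hFP : F ≤ P)
    (hface : ∀ a ∈ P, ∀ b ∈ P, a + b ∈ F → a ∈ F) : F.FG := by
  classical
  obtain ⟨S, hS⟩ := hP
  have hface' : ∀ a ∈ P, ∀ b ∈ P, a + b ∈ F → b ∈ F := fun a ha b hb hab =>
    hface b hb a ha (by rwa [add_comm])
  refine ⟨S.filter (fun s => (s : G) ∈ F), le_antisymm ?_ ?_⟩
  · refine AddSubmonoid.closure_le.2 fun s hs => ?_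
    rw [Finset.coe_filter] at hs
    exact hs.2
  · intro x hx
    have hxP : x ∈ AddSubmonoid.closure (S : Set G) := by rw [hS]; exact hFP hx
    -- induction on `x ∈ closure S`, carrying `x ∈ F`
    induction hxP using AddSubmonoid.closure_induction with
    | mem y hy =>
      exact AddSubmonoid.subset_closure (by rw [Finset.coe_filter]; exact ⟨hy, hx⟩)
    | zero => exact AddSubmonoid.zero_mem _
    | add a b ha hb iha ihb =>
      have haP : a ∈ P := by rw [← hS]; exact ha
      have hbP : b ∈ P := by rw [← hS]; exact hb
      exact AddSubmonoid.add_mem _ (iha (hface a haP b hbP hx)) (ihb (hface' a haP b hbP hx))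

/-- The face of the tautological chart `P → k[P]` at `𝔭` (Kato's `F_𝔭`), as a subset of `ℤⁿ`, is the face of
`𝔭`. [folklore] -/
theorem image_logChartFace_eq (𝔭 : Ideal (AddMonoidAlgebra k ↥P)) [𝔭.IsPrime] (F : AddSubmonoid (Fin n → ℤ))
    (hFP : F ≤ P) (hF : ∀ p : ↥P, (p : Fin n → ℤ) ∈ F ↔ AddMonoidAlgebra.single p (1 : k) ∉ 𝔭) :
    (fun p : ↥P => (p : Fin n → ℤ)) '' LogChart.face P (AddMonoidAlgebra.of k ↥P) 𝔭 = (F : Set (Fin n → ℤ)) := by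
  ext g
  constructor
  · rintro ⟨p, hp, rfl⟩
    rw [LogChart.mem_face_iff, AddMonoidAlgebra.of_apply, toAdd_ofAdd] at hp
    exact (hF p).2 hp
  · intro hg
    refine ⟨⟨g, hFP hg⟩, ?_, rfl⟩
    rw [LogChart.mem_face_iff, AddMonoidAlgebra.of_apply, toAdd_ofAdd]
    exact (hF ⟨g, hFP hg⟩).1 hg

/-- Kato's ideal `I(𝔭)` of the tautological chart is the monomial ideal of `P ∖ F`. [folklore] -/
theorem logChartIdeal_eq (𝔭 : Ideal (AddMonoidAlgebra k ↥P)) [𝔭.IsPrime] (F : AddSubmonoid (Fin n → ℤ))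
    (hF : ∀ p : ↥P, (p : Fin n → ℤ) ∈ F ↔ AddMonoidAlgebra.single p (1 : k) ∉ 𝔭) :
    LogChart.ideal P (AddMonoidAlgebra.of k ↥P) 𝔭 =
      Ideal.span ((fun p : ↥P => AddMonoidAlgebra.single p (1 : k)) '' {p : ↥P | (p : Fin n → ℤ) ∉ F}) := by
  unfold LogChart.ideal
  congr 1
  ext x
  constructor
  · rintro ⟨p, hp, rfl⟩
    rw [Set.mem_setOf_eq, AddMonoidAlgebra.of_apply, toAdd_ofAdd] at hp
    refine ⟨p, ?_, ?_⟩
    · rw [Set.mem_setOf_eq, hF, not_not]; exact hp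
    · change AddMonoidAlgebra.single p (1 : k) = AddMonoidAlgebra.of k ↥P (Multiplicative.ofAdd p)
      rw [AddMonoidAlgebra.of_apply, toAdd_ofAdd]
  · rintro ⟨p, hp, rfl⟩
    rw [Set.mem_setOf_eq, hF, not_not] at hp
    refine ⟨p, ?_, ?_⟩
    · rw [Set.mem_setOf_eq, AddMonoidAlgebra.of_apply, toAdd_ofAdd]; exact hp
    · change AddMonoidAlgebra.of k ↥P (Multiplicative.ofAdd p) = AddMonoidAlgebra.single p (1 : k)
      rw [AddMonoidAlgebra.of_apply, toAdd_ofAdd]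

/-- Arithmetic of the dimension count: from `d + x = n` and `d + y = r` (in `WithBot ℕ∞`, `d, n, r ∈ ℕ`) one gets
`x = y + (n − r)`. [folklore] -/
theorem withBot_enat_eq_add_sub {d n r : ℕ} {x y : ℕ∞} (hr : r ≤ n)
    (h1 : (d : WithBot ℕ∞) + (x : WithBot ℕ∞) = n) (h2 : (d : WithBot ℕ∞) + (y : WithBot ℕ∞) = r) :
    (x : WithBot ℕ∞) = (y : WithBot ℕ∞) + ((n - r : ℕ) : WithBot ℕ∞) := by
  have h1' : (d : ℕ∞) + x = n := by
    have : ((d : ℕ∞) : WithBot ℕ∞) + (x : WithBot ℕ∞) = ((n : ℕ∞) : WithBot ℕ∞) := h1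
    rw [← WithBot.coe_add] at this
    exact WithBot.coe_injective this
  have h2' : (d : ℕ∞) + y = r := by
    have : ((d : ℕ∞) : WithBot ℕ∞) + (y : WithBot ℕ∞) = ((r : ℕ∞) : WithBot ℕ∞) := h2
    rw [← WithBot.coe_add] at this
    exact WithBot.coe_injective this
  induction x using ENat.recTopCoe with
  | top => simp at h1'
  | coe x =>
    induction y using ENat.recTopCoe with
    | top => simp at h2'
    | coe y =>
      have e1 : d + x = n := by exact_mod_cast h1'
      have e2 : d + y = r := by exact_mod_cast h2'
      have : x = y + (n - r) := by omega
      rw [this]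
      rfl

/-- **Kato's logarithmic regularity (Def. (2.1)) of the toric algebra `k[P]` at every prime**, for the
tautological chart `P → k[P]` of a finitely generated `P ⊆ ℤⁿ` spanning `ℤⁿ` (no saturation needed): with `F` the
face of `𝔭`, (i) `k[P]_𝔭/(x^p : p ∉ F) ≅ k[F]_𝔮` is a localization of the regular ring `k[ℤF]` at a prime, and
(ii) `dim k[P]_𝔭 = dim k[F]_𝔮 + (n − rank ℤF)` by the dimension formula for affine domains.
[cite: Kato1994, Def. (2.1), (2.2), (3.2)] -/
theorem isLogRegularAt_addMonoidAlgebra (hP : P.FG) (hspan : Submodule.span ℤ (P : Set (Fin n → ℤ)) = ⊤)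
    (𝔭 : Ideal (AddMonoidAlgebra k ↥P)) [𝔭.IsPrime] :
    LogChart.IsLogRegularAt P (AddMonoidAlgebra.of k ↥P) 𝔭 := by
  classical
  obtain ⟨F, hFP, hface, hF⟩ := exists_face_of_isPrime k P 𝔭
  have hFfg : F.FG := addSubmonoid_fg_of_face hP hFP hface
  have hI := logChartIdeal_eq k P 𝔭 F hF
  have himg := image_logChartFace_eq k P 𝔭 F hFP hF
  -- the face retraction `π : k[P] → k[F]` and the prime `𝔮 = π(𝔭)`
  obtain ⟨π, hπ₁, hπ₂⟩ := exists_faceRetraction k (P := P) (F := F) hface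
  have hsurj := faceRetraction_surjective hFP π hπ₁
  have hker : RingHom.ker π = LogChart.ideal P (AddMonoidAlgebra.of k ↥P) 𝔭 := by
    rw [hI]; exact faceRetraction_ker hFP π hπ₁ hπ₂
  have hkerle : RingHom.ker π ≤ 𝔭 := by rw [hker]; exact LogChart.ideal_le P _ 𝔭
  set 𝔮 : Ideal (AddMonoidAlgebra k ↥F) := 𝔭.map π with h𝔮def
  haveI h𝔮 : 𝔮.IsPrime := Ideal.map_isPrime_of_surjective hsurj hkerle
  have hcomap : 𝔮.comap π = 𝔭 := by
    rw [h𝔮def, Ideal.comap_map_of_surjective _ hsurj, sup_eq_left, ← RingHom.ker_eq_comap_bot]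
    exact hkerle
  have hmem : ∀ x, π x ∈ 𝔮 ↔ x ∈ 𝔭 := fun x => by
    rw [← Ideal.mem_comap, hcomap]
  -- no monomial of `F` lies in `𝔮`
  have hdisj : Disjoint ((MonoidHom.mrange (AddMonoidAlgebra.of k ↥F) : Set (AddMonoidAlgebra k ↥F)))
      (𝔮 : Set (AddMonoidAlgebra k ↥F)) := by
    refine Set.disjoint_left.2 ?_
    rintro _ ⟨f, rfl⟩ h
    have hf : ((⟨((Multiplicative.toAdd f : ↥F) : Fin n → ℤ), hFP (Multiplicative.toAdd f).2⟩ : ↥P) :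
        Fin n → ℤ) ∈ F := (Multiplicative.toAdd f).2
    have h1 := hπ₁ ⟨((Multiplicative.toAdd f : ↥F) : Fin n → ℤ), hFP (Multiplicative.toAdd f).2⟩ hf 1
    have h2 : (AddMonoidAlgebra.of k ↥F f : AddMonoidAlgebra k ↥F) =
        AddMonoidAlgebra.single (⟨_, hf⟩ : ↥F) 1 := by
      rw [AddMonoidAlgebra.of_apply]
    rw [SetLike.mem_coe, h2, ← h1, hmem] at h
    exact ((hF _).1 hf) h
  -- `k[ℤF]` is a localization of `k[F]` and a regular ring, so `k[F]_𝔮` is regular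
  set H : Submodule ℤ (Fin n → ℤ) := Submodule.span ℤ (F : Set (Fin n → ℤ)) with hHdef
  let ι : ↥F →+ ↥H :=
    { toFun := fun q => ⟨(q : Fin n → ℤ), Submodule.subset_span q.2⟩
      map_zero' := rfl
      map_add' := fun _ _ => rfl }
  have hι : Function.Injective ι := fun a b hab => by
    have h := congrArg Subtype.val hab
    exact Subtype.ext h
  have hgen : ∀ γ : ↥H, ∃ a b : ↥F, γ + ι b = ι a := by
    rintro ⟨γ, hγ⟩
    obtain ⟨a, ha, b, hb, hab⟩ := exists_add_eq_of_mem_span F hγ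
    exact ⟨⟨a, ha⟩, ⟨b, hb⟩, Subtype.ext hab⟩
  have hreg𝔮 : IsRegularLocalRing (Localization.AtPrime 𝔮) := by
    let f : AddMonoidAlgebra k ↥F →ₐ[k] AddMonoidAlgebra k ↥H := AddMonoidAlgebra.mapDomainAlgHom k k ι
    letI : Algebra (AddMonoidAlgebra k ↥F) (AddMonoidAlgebra k ↥H) := f.toRingHom.toAlgebra
    have halg : (algebraMap (AddMonoidAlgebra k ↥F) (AddMonoidAlgebra k ↥H) :
        AddMonoidAlgebra k ↥F →+* AddMonoidAlgebra k ↥H) = mapDomainRingHom k ι :=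
      RingHom.ext fun _ => rfl
    haveI : IsLocalization (MonoidHom.mrange (AddMonoidAlgebra.of k ↥F)) (AddMonoidAlgebra k ↥H) :=
      isLocalization_of_mapDomain k ι hι hgen halg
    haveI : IsRegularRing (AddMonoidAlgebra k ↥H) := isRegularRing_addMonoidAlgebra_of_free k ↥H
    exact isRegularLocalRing_localization_atPrime_of_isLocalization_of_disjoint
      (MonoidHom.mrange (AddMonoidAlgebra.of k ↥F)) (AddMonoidAlgebra k ↥H) 𝔮 hdisj
  -- `T = k[P]_𝔭 / I k[P]_𝔭` is the localization of `k[F] ≅ k[P]/I` at `𝔮`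
  set I := LogChart.ideal P (AddMonoidAlgebra.of k ↥P) 𝔭 with hIdef
  let e : (AddMonoidAlgebra k ↥P ⧸ I) ≃ₐ[k] AddMonoidAlgebra k ↥F :=
    (Ideal.quotientEquivAlgOfEq k hker.symm).trans (Ideal.quotientKerAlgEquivOfSurjective hsurj)
  have he : ∀ a, e (Ideal.Quotient.mk I a) = π a := fun a => by
    simp only [e, AlgEquiv.trans_apply, Ideal.quotientEquivAlgOfEq_mk, Ideal.quotientKerAlgEquivOfSurjective_mk]
  let h : (AddMonoidAlgebra k ↥P ⧸ I) ≃+* AddMonoidAlgebra k ↥F := e.toRingEquiv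
  have hh : ∀ a, h (Ideal.Quotient.mk I a) = π a := he
  letI algT : Algebra (AddMonoidAlgebra k ↥F)
      (Localization.AtPrime 𝔭 ⧸ I.map (algebraMap (AddMonoidAlgebra k ↥P) (Localization.AtPrime 𝔭))) :=
    @RingHom.toAlgebra (AddMonoidAlgebra k ↥F)
      (Localization.AtPrime 𝔭 ⧸ I.map (algebraMap (AddMonoidAlgebra k ↥P) (Localization.AtPrime 𝔭))) _ _
      ((algebraMap (AddMonoidAlgebra k ↥P ⧸ I)
        (Localization.AtPrime 𝔭 ⧸ I.map (algebraMap (AddMonoidAlgebra k ↥P) (Localization.AtPrime 𝔭)))).comp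
          h.symm.toRingHom)
  have hlocT := IsLocalization.isLocalization_of_base_ringEquiv
    (Algebra.algebraMapSubmonoid (AddMonoidAlgebra k ↥P ⧸ I) 𝔭.primeCompl)
    (Localization.AtPrime 𝔭 ⧸ I.map (algebraMap (AddMonoidAlgebra k ↥P) (Localization.AtPrime 𝔭))) h
  have hM : (Algebra.algebraMapSubmonoid (AddMonoidAlgebra k ↥P ⧸ I) 𝔭.primeCompl).map
      h.toMonoidHom = 𝔮.primeCompl := by
    ext y
    constructor
    · rintro ⟨m, ⟨a, ha, rfl⟩, rfl⟩
      change h (algebraMap _ _ a) ∉ 𝔮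
      rw [Ideal.Quotient.algebraMap_eq, hh, hmem]
      exact ha
    · intro hy
      obtain ⟨a, rfl⟩ := hsurj y
      refine ⟨Ideal.Quotient.mk I a, ⟨a, ?_, rfl⟩, hh a⟩
      change a ∉ 𝔭
      rw [← hmem]; exact hy
  haveI hlocT' : @IsLocalization.AtPrime _ _
      (Localization.AtPrime 𝔭 ⧸ I.map (algebraMap (AddMonoidAlgebra k ↥P) (Localization.AtPrime 𝔭))) _ algT 𝔮
      h𝔮 := by
    change @IsLocalization _ _ 𝔮.primeCompl
      (Localization.AtPrime 𝔭 ⧸ I.map (algebraMap (AddMonoidAlgebra k ↥P) (Localization.AtPrime 𝔭))) _ algT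
    rw [← hM]
    exact hlocT
  have hTiso : Nonempty
      ((Localization.AtPrime 𝔭 ⧸ I.map (algebraMap (AddMonoidAlgebra k ↥P) (Localization.AtPrime 𝔭))) ≃+*
        Localization.AtPrime 𝔮) :=
    ⟨(@IsLocalization.algEquiv _ _ 𝔮.primeCompl
      (Localization.AtPrime 𝔭 ⧸ I.map (algebraMap (AddMonoidAlgebra k ↥P) (Localization.AtPrime 𝔭))) _ algT
      hlocT' (Localization.AtPrime 𝔮) _ _ _).toRingEquiv⟩
  obtain ⟨eT'⟩ := hTiso
  refine ⟨IsRegularLocalRing.of_ringEquiv eT'.symm, ?_⟩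
  -- (ii) the dimension count
  rw [himg]
  haveI : UniqueSums ↥P := uniqueSums_addSubmonoid P
  haveI : UniqueSums ↥F := uniqueSums_addSubmonoid F
  haveI : IsDomain (AddMonoidAlgebra k ↥P) := inferInstance
  haveI : IsDomain (AddMonoidAlgebra k ↥F) := inferInstance
  haveI : AddMonoid.FG ↥P := (AddMonoid.fg_iff_addSubmonoid_fg P).2 hP
  haveI : AddMonoid.FG ↥F := (AddMonoid.fg_iff_addSubmonoid_fg F).2 hFfg
  haveI : Algebra.FiniteType k (AddMonoidAlgebra k ↥P) := AddMonoidAlgebra.finiteType_of_fg k _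
  haveI : Algebra.FiniteType k (AddMonoidAlgebra k ↥F) := AddMonoidAlgebra.finiteType_of_fg k _
  have hdimA : ringKrullDim (AddMonoidAlgebra k ↥P) = n := by
    rw [ringKrullDim_addMonoidAlgebra_eq_finrank_span k P hP, hspan, finrank_top, Module.finrank_fin_fun]
  have hdimB : ringKrullDim (AddMonoidAlgebra k ↥F) = Module.finrank ℤ ↥H :=
    ringKrullDim_addMonoidAlgebra_eq_finrank_span k F hFfg
  have hA := Literature.RingTheory.KrullDimension.ringKrullDim_quotient_add_height k 𝔭
  have hB := Literature.RingTheory.KrullDimension.ringKrullDim_quotient_add_height k 𝔮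
  -- `k[P]/𝔭 ≅ k[F]/𝔮`
  have hquot : ringKrullDim (AddMonoidAlgebra k ↥F ⧸ 𝔮) = ringKrullDim (AddMonoidAlgebra k ↥P ⧸ 𝔭) := by
    let g : AddMonoidAlgebra k ↥P →+* AddMonoidAlgebra k ↥F ⧸ 𝔮 := (Ideal.Quotient.mk 𝔮).comp π.toRingHom
    have hg : Function.Surjective g := Ideal.Quotient.mk_surjective.comp hsurj
    have hgker : RingHom.ker g = 𝔭 := by
      rw [← RingHom.comap_ker, Ideal.mk_ker]
      exact hcomap
    exact (ringKrullDim_eq_of_ringEquiv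
      ((Ideal.quotEquivOfEq hgker.symm).trans (RingHom.quotientKerEquivOfSurjective hg))).symm
  haveI : IsDomain (AddMonoidAlgebra k ↥P ⧸ 𝔭) := Ideal.Quotient.isDomain 𝔭
  obtain ⟨d, hd, -⟩ :=
    Literature.RingTheory.KrullDimension.exists_ringKrullDim_eq_and_trdeg_eq k (AddMonoidAlgebra k ↥P ⧸ 𝔭)
  rw [hd, hdimA] at hA
  rw [hquot, hd, hdimB] at hB
  rw [IsLocalization.AtPrime.ringKrullDim_eq_height 𝔭 (Localization.AtPrime 𝔭),
    ringKrullDim_eq_of_ringEquiv eT', IsLocalization.AtPrime.ringKrullDim_eq_height 𝔮 (Localization.AtPrime 𝔮)]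
  have hr : Module.finrank ℤ ↥H ≤ n := by
    have h := Submodule.finrank_le H
    rwa [Module.finrank_fin_fun] at h
  exact withBot_enat_eq_add_sub hr hA hB

/-- **Every affine normal toric variety over every field has a resolution of singularities.** For a field `k`
and a finitely generated, saturated submonoid `P ⊆ ℤⁿ` spanning `ℤⁿ` (an fs monoid with `Pᵍᵖ = ℤⁿ`), the scheme
`Spec k[P]` admits a proper birational morphism from a regular scheme: the tautological chart is log regular at
every prime (`isLogRegularAt_addMonoidAlgebra`) and Kato's theorem (10.4) — PROVED in the tree,
`Kato1994_logRegular_hasResolution_holds` — resolves log regular affine schemes by fan subdivision. Covers all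
`𝔸ⁿ/D(A)` for diagonal actions of finite diagonalizable group schemes (tame or wild), in every dimension.
(The classical statement: Cox–Little–Schenck, *Toric Varieties*, Thm. 11.1.9, there over `ℂ`.)
[cite: Kato1994, (10.4)] -/
theorem hasResolution_Spec_addMonoidAlgebra (hP : P.FG)
    (hsat : ∀ (v : Fin n → ℤ) (m : ℕ), 0 < m → m • v ∈ P → v ∈ P)
    (hspan : Submodule.span ℤ (P : Set (Fin n → ℤ)) = ⊤) :
    Scheme.HasResolution (AlgebraicGeometry.Spec (.of (AddMonoidAlgebra k ↥P))) := by
  haveI : AddMonoid.FG ↥P := (AddMonoid.fg_iff_addSubmonoid_fg P).2 hP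
  haveI : Algebra.FiniteType k (AddMonoidAlgebra k ↥P) := AddMonoidAlgebra.finiteType_of_fg k _
  haveI : IsNoetherianRing (AddMonoidAlgebra k ↥P) := Algebra.FiniteType.isNoetherianRing k _
  exact Kato1994_logRegular_hasResolution_holds (AddMonoidAlgebra k ↥P) n P (AddMonoidAlgebra.of k ↥P) hP hsat
    hspan (fun 𝔭 _ => isLogRegularAt_addMonoidAlgebra k P hP hspan 𝔭)

end Summit.ResolutionOfSingularities.ResolutionOfSingularities.Theorems.FRationalResolution

end
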